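import Literature.Analysis.FluidPDE.AxisymJEnergy
import Literature.Analysis.FluidPDE.AxisymJSourceEstimate
import Literature.Analysis.FluidPDE.LeiZhang2017FBC
import Literature.Analysis.FluidPDE.AxisymGradientField
import Literature.Analysis.FluidPDE.AxisymOuterBounds
import HarnessLib

/-!
# Lei–Zhang 2017, proof of Thm. 1.2 / Cor. 1.3: the differential inequality (E5) + 3C_*²(E6)
# at a fixed time, under the critical modulus `|Γ| ≤ C₁/ln²r`

Analysis/FluidPDE proof file (theorems only; no definitions, no named facts) on the discharge path
of the named fact `Literature.Analysis.FluidPDE.LeiZhang2017_logModulus_regularity`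
(Lei–Zhang 2017, arXiv:1505.02628, Cor. 1.3). The a-priori estimate of §3 (arXiv pp. 8–9):

> (E3) `½ d/dt‖J‖² + ‖∇J‖² + ∫|J(t,0,z)|²dz = ∫ J(ωʳ∂ᵣ + ωᶻ∂_z)(vʳ/r)`,
> (E4) `½ d/dt‖Ω‖² + ‖∇Ω‖² + ∫|Ω(t,0,z)|²dz = −2∫(v^θ/r)JΩ`,
> (E1) `|∫(v^θ/r)JΩ| ≤ ¼∫|∂ᵣΩ|² + C_*²∫|∂ᵣJ|² + C∫_{r≥r₀}(|J|² + |Ω|²)`   (FBC-1),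
> (E2) `|∫J(ωʳ∂ᵣ + ωᶻ∂_z)(vʳ/r)| ≤ ½‖∇J‖² + (K₀δ_*/2)‖∂_zΩ‖² + C∫|∇v|²`   (FBC-2, Lemma 2.1),
> "Multiplying (E6) by `3C_*²` and then adding it up with (E5), we have
> `d/dt(3C_*²‖J‖² + ‖Ω‖²) + (C_*²‖∇J‖² + ‖∇Ω‖²) + … ≤ K₀δ_*‖∇Ω‖² + C∫|∇v|²`."

Here all ingredients are in the tree for a classical axisymmetric solution at a fixed time, in
the smooth Hou–Li variables `Ω = angVortQuot`, `J = radVelQuot ∘ curl`, `Φ = angVelQuot = v^θ/r`,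
`W = radVelQuot = vʳ/r` (axis terms already dropped, `≤`):
`IsClassicalNSSolutionOn.angVortQuot_energy_le` (E4), `…radVelQuot_curl_energy_le` (E3),
`integral_mul_fderiv_apply_curl_le` (the pairing of (E2)), `LeiZhang2017.integral_abs_angVelQuot_mul_norm_sq_le`
/ `…integral_swirl_sq_mul_norm_sq_le` (FBC-1/2 from the modulus, `C_* = 16C₁`,
`δ_* = 16C₁²/ln²(2δ)`), `IsAxisymmetric.integral_norm_fderiv_gradient_radVelQuot_eR_sq_le`
(Lemma 2.1, `K₀ = 1`), and the outer-region absorptions of `AxisymOuterBounds`. This file adds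
them up:

* `LeiZhang2017.slice_inequality` — for a classical solution of the unforced system (`ν = 1`) on
  `S ⊆ closure (interior S)` with axisymmetric velocity, at `t ∈ S`, under the modulus
  `|Γ(x)| ≤ C₁/ln²r(x)` (`0 < r ≤ 2δ`, `2δ < 1`), `|Γ| ≤ M`, the smallness
  `65536 C₁⁴ ≤ ln²(2δ)` (i.e. `4C_*²δ_* ≤ ¼`), and square-integrability / boundedness hypotheses
  valid in Tao's class:
  `∫ΩΩ' + 8C_*²∫JJ' + ¼∫|∇Ω|² + 2C_*²∫|∇J|² ≤ K (∫‖v‖² + ∫‖Dv‖²)`,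
  with `Ω' = angVortQuot (∂ₜv)`, `J' = radVelQuot (curl ∂ₜv)` and an explicit constant
  `K = K(C₁, M, δ)` (the weight `8C_*²` instead of the printed `3C_*²` absorbs the factor `½` of
  the Young step of (E2) and the constant `4` of the log-Hardy inequality).

## References

* Z. Lei, Q. S. Zhang, Pacific J. Math. 289 (2017) 169–187, arXiv:1505.02628, §3 (E1)–(E7),
  pp. 8–9. [`LeiZhang2017`]
-/

noncomputable section

open MeasureTheory Set Function Filter Topology InnerProductSpace WithLp
open scoped RealInnerProductSpace Laplacian ContDiff ENNReal

namespace Literature.Analysis.FluidPDE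

namespace LeiZhang2017

section Slice

variable {S : Set ℝ} {v : ℝ → EuclideanSpace ℝ (Fin 3) → EuclideanSpace ℝ (Fin 3)}
  {q : ℝ → EuclideanSpace ℝ (Fin 3) → ℝ}

/-- `‖∇W(x)‖ = ‖DW(x)‖` (Riesz; private copy of the tree's `norm_gradient_eq_norm_fderiv`). [folklore] -/
private theorem norm_gradient_eq_opNorm_fderiv (W : EuclideanSpace ℝ (Fin 3) → ℝ) (x : EuclideanSpace ℝ (Fin 3)) :
    ‖gradient W x‖ = ‖fderiv ℝ W x‖ := by
  rw [gradient]
  exact (InnerProductSpace.toDual ℝ (EuclideanSpace ℝ (Fin 3))).symm.norm_map _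

set_option maxHeartbeats 800000 in
/-- **The slice inequality** (Lei–Zhang 2017, §3: (E5) + 8C_*²·(E6) at a fixed time, axis terms
dropped). See the module docstring. [cite: LeiZhang2017, §3 (E1)–(E7) (arXiv pp. 8–9)] -/
theorem slice_inequality (hns : IsClassicalNSSolutionOn S 1 0 v q) (hS : UniqueDiffOn ℝ S)
    (hcl : S ⊆ closure (interior S)) (hax : ∀ s ∈ S, IsAxisymmetric (v s)) {t : ℝ} (ht : t ∈ S)
    {C₁ M δ : ℝ} (hC₁ : 1 ≤ C₁) (hM : 0 ≤ M) (hδ : 0 < δ) (h2δ : 2 * δ < 1)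
    (hsmall : 65536 * C₁ ^ 4 ≤ Real.log (2 * δ) ^ 2)
    (hmod : ∀ x, 0 < cylRadius x → cylRadius x ≤ 2 * δ →
      |swirl (v t) x| ≤ C₁ / Real.log (cylRadius x) ^ 2)
    (hbd : ∀ x, |swirl (v t) x| ≤ M)
    {B : ℝ} (huB : ∀ x, ‖v t x‖ ≤ B) {B' : ℝ} (hDu : ∀ x, ‖fderiv ℝ (v t) x‖ ≤ B')
    (hu0 : Integrable (fun x => ‖v t x‖ ^ 2)) (hu1 : Integrable (fun x => ‖fderiv ℝ (v t) x‖ ^ 2))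
    (hΩ0 : MemLp (angVortQuot (v t)) 2 volume)
    (hΩ1 : ∀ i : Fin 3, MemLp (fun x => fderiv ℝ (angVortQuot (v t)) x (EuclideanSpace.single i 1)) 2 volume)
    (hΩ2 : ∀ i : Fin 3, MemLp (fun x => fderiv ℝ (fun y => fderiv ℝ (angVortQuot (v t)) y
      (EuclideanSpace.single i 1)) x (EuclideanSpace.single i 1)) 2 volume)
    (hqΩ : MemLp (radDerivQuot (angVortQuot (v t))) 2 volume)
    (hJ0 : MemLp (radVelQuot (curl (v t))) 2 volume)
    (hJ1 : ∀ i : Fin 3, MemLp (fun x => fderiv ℝ (radVelQuot (curl (v t))) x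
      (EuclideanSpace.single i 1)) 2 volume)
    (hJ2 : ∀ i : Fin 3, MemLp (fun x => fderiv ℝ (fun y => fderiv ℝ (radVelQuot (curl (v t))) y
      (EuclideanSpace.single i 1)) x (EuclideanSpace.single i 1)) 2 volume)
    (hqJ : MemLp (radDerivQuot (radVelQuot (curl (v t)))) 2 volume)
    (hW1 : ∀ i : Fin 3, MemLp (fun x => fderiv ℝ (radVelQuot (v t)) x (EuclideanSpace.single i 1)) 2 volume)
    (hW2 : ∀ i j : Fin 3, MemLp (fun x => fderiv ℝ (fun y => fderiv ℝ (radVelQuot (v t)) y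
      (EuclideanSpace.single i 1)) x (EuclideanSpace.single j 1)) 2 volume)
    (hW3 : ∀ i j : Fin 3, MemLp (fun x => fderiv ℝ (fun y => fderiv ℝ (fun z => fderiv ℝ (radVelQuot (v t)) z
      (EuclideanSpace.single i 1)) y (EuclideanSpace.single j 1)) x (EuclideanSpace.single j 1)) 2 volume)
    (hqW : MemLp (radDerivQuot (radVelQuot (v t))) 2 volume)
    (hqW2 : MemLp (radDerivQuot fun y => fderiv ℝ (radVelQuot (v t)) y (EuclideanSpace.single 2 1)) 2 volume)
    {K : ℝ} (hK : K = ((16 * C₁ * Wei2016.stDerivBound ^ 2 + 2 * M) / δ ^ 2 / (2 * (16 * C₁)) +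
        2 * (16 * C₁) * ((16 * C₁ * Wei2016.stDerivBound ^ 2 + 2 * M) / δ ^ 2)) *
        ‖(curlCLM : (EuclideanSpace ℝ (Fin 3) →L[ℝ] EuclideanSpace ℝ (Fin 3)) →L[ℝ]
          EuclideanSpace ℝ (Fin 3))‖ ^ 2 * δ⁻¹ ^ 2 +
      4 * (16 * C₁) ^ 2 * ((16 * C₁ ^ 2 * Wei2016.stDerivBound ^ 2 / Real.log (2 * δ) ^ 2 + 2 * M ^ 2) / δ ^ 2) *
        (18 / δ ^ 4 + 2 / δ ^ 2)) :
    (∫ x, angVortQuot (v t) x * angVortQuot (timeDerivWithin S v t) x) +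
      8 * (16 * C₁) ^ 2 * (∫ x, radVelQuot (curl (v t)) x * radVelQuot (curl (timeDerivWithin S v t)) x) +
      (1 / 4) * (∫ x, (fderiv ℝ (angVortQuot (v t)) x (EuclideanSpace.single 0 1) ^ 2 +
        fderiv ℝ (angVortQuot (v t)) x (EuclideanSpace.single 1 1) ^ 2 +
        fderiv ℝ (angVortQuot (v t)) x (EuclideanSpace.single 2 1) ^ 2)) +
      2 * (16 * C₁) ^ 2 * (∫ x, (fderiv ℝ (radVelQuot (curl (v t))) x (EuclideanSpace.single 0 1) ^ 2 +
        fderiv ℝ (radVelQuot (curl (v t))) x (EuclideanSpace.single 1 1) ^ 2 +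
        fderiv ℝ (radVelQuot (curl (v t))) x (EuclideanSpace.single 2 1) ^ 2)) ≤
      K * ((∫ x, ‖v t x‖ ^ 2) + ∫ x, ‖fderiv ℝ (v t) x‖ ^ 2) := by
  /- ───── names ───── -/
  set u : EuclideanSpace ℝ (Fin 3) → EuclideanSpace ℝ (Fin 3) := v t with hu_def
  set Ω : EuclideanSpace ℝ (Fin 3) → ℝ := angVortQuot u with hΩ_def
  set J : EuclideanSpace ℝ (Fin 3) → ℝ := radVelQuot (curl u) with hJ_def
  set Φ : EuclideanSpace ℝ (Fin 3) → ℝ := angVelQuot u with hΦ_def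
  set W : EuclideanSpace ℝ (Fin 3) → ℝ := radVelQuot u with hW_def
  set c : ℝ := ‖(curlCLM : (EuclideanSpace ℝ (Fin 3) →L[ℝ] EuclideanSpace ℝ (Fin 3)) →L[ℝ]
      EuclideanSpace ℝ (Fin 3))‖ with hc_def
  set D : ℝ := Wei2016.stDerivBound with hD_def
  set Cs : ℝ := 16 * C₁ with hCs_def
  set L2 : ℝ := Real.log (2 * δ) ^ 2 with hL2_def
  set C0 : ℝ := (16 * C₁ * D ^ 2 + 2 * M) / δ ^ 2 with hC0_def
  set C0' : ℝ := (16 * C₁ ^ 2 * D ^ 2 / L2 + 2 * M ^ 2) / δ ^ 2 with hC0'_def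
  set δs : ℝ := 16 * C₁ ^ 2 / L2 with hδs_def
  -- integral quantities
  set GΩ : ℝ := ∫ x, (fderiv ℝ Ω x (EuclideanSpace.single 0 1) ^ 2 +
    fderiv ℝ Ω x (EuclideanSpace.single 1 1) ^ 2 + fderiv ℝ Ω x (EuclideanSpace.single 2 1) ^ 2) with hGΩ
  set GJ : ℝ := ∫ x, (fderiv ℝ J x (EuclideanSpace.single 0 1) ^ 2 +
    fderiv ℝ J x (EuclideanSpace.single 1 1) ^ 2 + fderiv ℝ J x (EuclideanSpace.single 2 1) ^ 2) with hGJ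
  set E0 : ℝ := ∫ x, ‖u x‖ ^ 2 with hE0
  set E1 : ℝ := ∫ x, ‖fderiv ℝ u x‖ ^ 2 with hE1
  /- ───── constants ───── -/
  have hC₁0 : 0 ≤ C₁ := by linarith
  have hCs0 : 0 < Cs := by rw [hCs_def]; linarith
  have hD0 : 0 ≤ D := Wei2016.stDerivBound_spec.1
  have hc0 : 0 ≤ c := by positivity
  have hL2pos : 0 < L2 := by
    rw [hL2_def]; exact sq_pos_of_neg (Real.log_neg (by positivity) h2δ)
  have hC00 : 0 ≤ C0 := by rw [hC0_def]; positivity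
  have hC0'0 : 0 ≤ C0' := by rw [hC0'_def]; positivity
  have hδs0 : 0 ≤ δs := by rw [hδs_def]; positivity
  have hE00 : 0 ≤ E0 := integral_nonneg fun x => by positivity
  have hE10 : 0 ≤ E1 := integral_nonneg fun x => by positivity
  /- ───── regularity ───── -/
  have hsm : IsSmoothSpaceTimeOn S v := hns.smooth_velocity
  have hv : ContDiff ℝ ∞ u := hns.contDiff_velocity ht
  have hu1c : ContDiff ℝ 1 u := hv.of_le (by norm_cast)
  have hu2 : ContDiff ℝ 2 u := hv.of_le (by norm_cast)
  have hu3 : ContDiff ℝ 3 u := hv.of_le (by norm_cast)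
  have hu6 : ContDiff ℝ 6 u := hv.of_le (by norm_cast)
  have hud : Differentiable ℝ u := hv.differentiable (by simp)
  have haxt : IsAxisymmetric u := hax t ht
  have hdiv : VectorCalculus.IsDivFree u := hns.divFree t ht
  have hω : ContDiff ℝ ∞ (curl u) := by
    rw [curl_eq_curlCLM_comp]; exact curlCLM.contDiff.comp (hv.fderiv_right (m := ∞) (by simp))
  have hω2 : ContDiff ℝ 2 (curl u) := hω.of_le (by norm_cast)
  have hω4 : ContDiff ℝ 4 (curl u) := hω.of_le (by norm_cast)
  have haxω : IsAxisymmetric (curl u) := haxt.curl hud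
  have hΩc2 : ContDiff ℝ 2 Ω := contDiff_angVortQuot (n := 2) (by exact_mod_cast hv.of_le (by norm_cast))
  have hΩc1 : ContDiff ℝ 1 Ω := hΩc2.of_le (by norm_num)
  have hΩd : Differentiable ℝ Ω := hΩc1.differentiable one_ne_zero
  have hΩax : IsAxisymmetricScalar Ω := haxt.isAxisymmetricScalar_angVortQuot hu3
  have hJc2 : ContDiff ℝ 2 J := contDiff_radVelQuot (n := 2) hω4
  have hJc1 : ContDiff ℝ 1 J := hJc2.of_le (by norm_num)
  have hJd : Differentiable ℝ J := hJc1.differentiable one_ne_zero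
  have hJax : IsAxisymmetricScalar J := haxω.isAxisymmetricScalar_radVelQuot hω2
  have hWc3 : ContDiff ℝ 3 W := contDiff_radVelQuot (n := 3) (by exact_mod_cast hv.of_le (by norm_cast))
  have hWc2 : ContDiff ℝ 2 W := hWc3.of_le (by norm_num)
  have hWc1 : ContDiff ℝ 1 W := hWc3.of_le (by norm_num)
  have hWd : Differentiable ℝ W := hWc1.differentiable one_ne_zero
  have hWax : IsAxisymmetricScalar W := haxt.isAxisymmetricScalar_radVelQuot hu2
  have hΦc0 : Continuous Φ := (contDiff_angVelQuot (n := 0) (by exact_mod_cast hu2)).continuous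
  have hΦb : ∀ x, |Φ x| ≤ B' := fun x => (haxt.abs_angVelQuot_le_norm_fderiv hu2 x).trans (hDu x)
  have hB'0 : 0 ≤ B' := (norm_nonneg _).trans (hDu 0)
  have hB0 : 0 ≤ B := (norm_nonneg _).trans (huB 0)
  have hΦm : AEStronglyMeasurable Φ volume := hΦc0.aestronglyMeasurable
  /- ───── Step 1: the `Ω`-inequality (E4) ───── -/
  have hRΩ : Integrable (fun x => Ω x * (Φ x * J x)) volume := by
    have h := (hΩ0.integrable_mul hJ0).bdd_mul hΦm (ae_of_all _ fun x => by
      rw [Real.norm_eq_abs]; exact hΦb x)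
    exact h.congr (Eventually.of_forall fun x => by simp only [Pi.mul_apply]; ring)
  have hA := hns.angVortQuot_energy_le hS hcl hax zero_le_one ht hΩ0 hΩ1 hΩ2 hqΩ hRΩ huB hDu
  rw [one_mul] at hA
  -- hA : aΩ + GΩ ≤ -2 ∫ Ω (Φ J)
  /- ───── Step 2: the `J`-inequality (E3) ───── -/
  -- `‖DW‖ ∈ L²`
  have hgradW_sq : ∀ x, ‖fderiv ℝ W x‖ ^ 2 = fderiv ℝ W x (EuclideanSpace.single 0 1) ^ 2 +
      fderiv ℝ W x (EuclideanSpace.single 1 1) ^ 2 + fderiv ℝ W x (EuclideanSpace.single 2 1) ^ 2 :=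
    fun x => by rw [← norm_gradient_eq_opNorm_fderiv, norm_gradient_sq]
  have iGW : Integrable (fun x => fderiv ℝ W x (EuclideanSpace.single 0 1) ^ 2 +
      fderiv ℝ W x (EuclideanSpace.single 1 1) ^ 2 + fderiv ℝ W x (EuclideanSpace.single 2 1) ^ 2) volume :=
    ((hW1 0).integrable_sq.add (hW1 1).integrable_sq).add (hW1 2).integrable_sq
  have iDWsq : Integrable (fun x => ‖fderiv ℝ W x‖ ^ 2) volume :=
    iGW.congr (Eventually.of_forall fun x => (hgradW_sq x).symm)
  have hDWc : Continuous (fderiv ℝ W) := hWc1.continuous_fderiv one_ne_zero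
  have hDWL2 : MemLp (fun x => ‖fderiv ℝ W x‖) 2 volume :=
    (memLp_two_iff_integrable_sq hDWc.norm.aestronglyMeasurable).2 iDWsq
  have hRJ : Integrable (fun x => J x * fderiv ℝ W x (curl u x)) volume := by
    have hdom : Integrable (fun x => (c * B') * (‖J x‖ * ‖fderiv ℝ W x‖)) volume :=
      (hJ0.norm.integrable_mul hDWL2).const_mul _
    have hmeas : AEStronglyMeasurable (fun x => J x * fderiv ℝ W x (curl u x)) volume :=
      (hJc1.continuous.mul (hDWc.clm_apply hω.continuous)).aestronglyMeasurable
    refine hdom.mono' hmeas (Eventually.of_forall fun x => ?_)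
    rw [Real.norm_eq_abs, abs_mul]
    have h1 : |fderiv ℝ W x (curl u x)| ≤ ‖fderiv ℝ W x‖ * (c * B') := by
      calc |fderiv ℝ W x (curl u x)| = ‖fderiv ℝ W x (curl u x)‖ := (Real.norm_eq_abs _).symm
        _ ≤ ‖fderiv ℝ W x‖ * ‖curl u x‖ := (fderiv ℝ W x).le_opNorm _
        _ ≤ ‖fderiv ℝ W x‖ * (c * ‖fderiv ℝ u x‖) := by
            gcongr; exact norm_curl_le_norm_curlCLM_mul u x
        _ ≤ ‖fderiv ℝ W x‖ * (c * B') := by gcongr; exact hDu x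
    calc |J x| * |fderiv ℝ W x (curl u x)| ≤ |J x| * (‖fderiv ℝ W x‖ * (c * B')) := by gcongr
      _ = c * B' * (‖J x‖ * ‖fderiv ℝ W x‖) := by rw [Real.norm_eq_abs]; ring
  have hBJ := hns.radVelQuot_curl_energy_le hS hcl hax zero_le_one ht hJ0 hJ1 hJ2 hqJ hRJ huB hDu
  rw [one_mul] at hBJ
  -- hBJ : aJ + GJ ≤ ∫ J · DW[ω]
  /- ───── Step 3: the pairing (E2) ───── -/
  have hC := integral_mul_fderiv_apply_curl_le hJc2 hWc2 hu1c hJax hWax hJ0 hW1 hJ1 hW2 huB hDu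
  -- hC : ∫ J·DW[ω] ≤ ½ GJ + ½ Sw
  /- ───── Step 4: (FBC-2) with `F = ∇W`, and Lemma 2.1 ───── -/
  have hF1 : ContDiff ℝ 1 (gradient W) := contDiff_gradient_of_succ (n := 1) (by exact_mod_cast hWc2)
  have hFn : IsAxisymmetricScalar fun x => ‖gradient W x‖ ^ 2 := isAxisymmetricScalar_norm_gradient_sq hWax hWd
  have hDFn : IsAxisymmetricScalar fun x => ‖fderiv ℝ (gradient W) x (eR x)‖ ^ 2 :=
    isAxisymmetricScalar_norm_fderiv_gradient_eR_sq hWax hWc2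
  obtain ⟨hBWi, hEW⟩ :=
    haxt.integral_norm_fderiv_gradient_radVelQuot_eR_sq_le hu6 hdiv hqW hW1 hW2 hW3 hqW2
  -- hEW : ∫ ‖D(∇W)[e_r]‖² ≤ ∫ (∂₂Ω)²
  have iCW : Integrable (fun x => ‖gradient W x‖ ^ 2) volume :=
    iGW.congr (Eventually.of_forall fun x => (norm_gradient_sq W x).symm)
  -- the weight `(r Φ)² ≤ ‖u‖² ≤ B²`
  have hrΦ : ∀ x, (cylRadius x * Φ x) ^ 2 ≤ ‖u x‖ ^ 2 := by
    intro x
    have hΓ := haxt.cylRadius_sq_mul_angVelQuot hu2 x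
    rcases eq_or_lt_of_le (cylRadius_nonneg x) with h0 | hpos
    · rw [← h0]; simp
    · have h1 : cylRadius x * |cylRadius x * Φ x| ≤ cylRadius x * ‖u x‖ := by
        calc cylRadius x * |cylRadius x * Φ x| = |cylRadius x ^ 2 * Φ x| := by
              rw [abs_mul, abs_mul, abs_of_pos hpos, abs_of_pos (pow_pos hpos 2)]; ring
          _ = |x 0 * u x 1 - x 1 * u x 0| := by rw [hΓ]; rfl
          _ ≤ cylRadius x * ‖u x‖ := abs_swirl_le_cylRadius_mul_norm' x (u x)
      have h2 := le_of_mul_le_mul_left h1 hpos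
      rw [← sq_abs]
      exact pow_le_pow_left₀ (abs_nonneg _) h2 2
  have hAiW : Integrable (fun x => (cylRadius x * angVelQuot u x) ^ 2 * ‖gradient W x‖ ^ 2) volume := by
    have hmeas : AEStronglyMeasurable (fun x => (cylRadius x * angVelQuot u x) ^ 2 * ‖gradient W x‖ ^ 2) volume :=
      (((continuous_cylRadius.mul hΦc0).pow 2).mul (hF1.continuous.norm.pow 2)).aestronglyMeasurable
    refine (iCW.const_mul (B ^ 2)).mono' hmeas (Eventually.of_forall fun x => ?_)
    rw [Real.norm_eq_abs, abs_of_nonneg (by positivity)]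
    have h1 : (cylRadius x * Φ x) ^ 2 ≤ B ^ 2 :=
      (hrΦ x).trans (pow_le_pow_left₀ (norm_nonneg _) (huB x) 2)
    exact mul_le_mul_of_nonneg_right h1 (sq_nonneg _)
  have hDfbc := integral_swirl_sq_mul_norm_sq_le (F := gradient W) haxt hu2 hF1 hFn hDFn hδ h2δ hC₁0
    hmod hbd hAiW hBWi iCW
  -- identify the weight of `hC` with `(r Φ)² ‖∇W‖²`
  have hSw : ∫ x, (swirl u x) ^ 2 / (x 0 ^ 2 + x 1 ^ 2) *
      (fderiv ℝ W x (EuclideanSpace.single 0 1) ^ 2 + fderiv ℝ W x (EuclideanSpace.single 1 1) ^ 2 +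
        fderiv ℝ W x (EuclideanSpace.single 2 1) ^ 2) =
      ∫ x, (cylRadius x * angVelQuot u x) ^ 2 * ‖gradient W x‖ ^ 2 := by
    refine integral_congr_ae (Eventually.of_forall fun x => ?_)
    beta_reduce
    rw [norm_gradient_sq W x]
    congr 1
    have hΓ := haxt.cylRadius_sq_mul_angVelQuot hu2 x
    rw [← cylRadius_sq]
    rcases eq_or_lt_of_le (cylRadius_nonneg x) with h0 | hpos
    · rw [← h0]; simp
    · -- `Γ²/r² = (rΦ)²` since `r²Φ = Γ`
      have : swirl u x = cylRadius x ^ 2 * angVelQuot u x := hΓ.symm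
      rw [this]
      field_simp
  rw [hSw] at hC
  /- ───── Step 5: Lemma 2.1 bound `∫(∂₂Ω)² ≤ GΩ` ───── -/
  have iGΩ : Integrable (fun x => fderiv ℝ Ω x (EuclideanSpace.single 0 1) ^ 2 +
      fderiv ℝ Ω x (EuclideanSpace.single 1 1) ^ 2 + fderiv ℝ Ω x (EuclideanSpace.single 2 1) ^ 2) volume :=
    ((hΩ1 0).integrable_sq.add (hΩ1 1).integrable_sq).add (hΩ1 2).integrable_sq
  have hzΩ : ∫ x, fderiv ℝ Ω x (EuclideanSpace.single 2 1) ^ 2 ≤ GΩ :=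
    integral_mono (hΩ1 2).integrable_sq iGΩ fun x => by
      nlinarith [sq_nonneg (fderiv ℝ Ω x (EuclideanSpace.single 0 1)),
        sq_nonneg (fderiv ℝ Ω x (EuclideanSpace.single 1 1))]
  /- ───── Step 6: the outer term of (FBC-2) ───── -/
  have hOutW : ∫ x in {x | δ < cylRadius x}, ‖gradient W x‖ ^ 2 ≤ 18 / δ ^ 4 * E0 + 2 / δ ^ 2 * E1 := by
    have heq : ∫ x in {x | δ < cylRadius x}, ‖gradient W x‖ ^ 2 =
        ∫ x in {x | δ < cylRadius x}, ‖fderiv ℝ W x‖ ^ 2 :=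
      integral_congr_ae (Eventually.of_forall fun x => by beta_reduce; rw [norm_gradient_eq_opNorm_fderiv])
    rw [heq]
    exact haxt.setIntegral_norm_fderiv_radVelQuot_sq_le hu3 hδ iDWsq.integrableOn hu0 hu1
  /- ───── Step 7: (E1) via (FBC-1) for `Ω` and `J` ───── -/
  obtain ⟨iωsq, hωsq⟩ := integral_norm_curl_sq_le hu1c hu1
  -- the FBC-1 bounds
  have hfbc1 : ∀ {F : EuclideanSpace ℝ (Fin 3) → ℝ}, ContDiff ℝ 1 F → IsAxisymmetricScalar F →
      MemLp F 2 volume → (∀ i : Fin 3, MemLp (fun x => fderiv ℝ F x (EuclideanSpace.single i 1)) 2 volume) →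
      ∫ x, |Φ x| * F x ^ 2 ≤ Cs * (∫ x, (fderiv ℝ F x (EuclideanSpace.single 0 1) ^ 2 +
        fderiv ℝ F x (EuclideanSpace.single 1 1) ^ 2 + fderiv ℝ F x (EuclideanSpace.single 2 1) ^ 2)) +
        C0 * ∫ x in {x | δ < cylRadius x}, F x ^ 2 := by
    intro F hF hFax hF0 hF1'
    have hFd : Differentiable ℝ F := hF.differentiable one_ne_zero
    have hFn' : IsAxisymmetricScalar fun x => ‖F x‖ ^ 2 := fun θ x => by
      simp only [hFax θ x]
    have hDFn' : IsAxisymmetricScalar fun x => ‖fderiv ℝ F x (eR x)‖ ^ 2 := fun θ x => by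
      simp only [hFax.fderiv_apply_eR hFd θ x]
    have iGF : Integrable (fun x => fderiv ℝ F x (EuclideanSpace.single 0 1) ^ 2 +
        fderiv ℝ F x (EuclideanSpace.single 1 1) ^ 2 + fderiv ℝ F x (EuclideanSpace.single 2 1) ^ 2) volume :=
      ((hF1' 0).integrable_sq.add (hF1' 1).integrable_sq).add (hF1' 2).integrable_sq
    have iFsq : Integrable (fun x => F x ^ 2) volume := hF0.integrable_sq
    have hAi : Integrable (fun x => |angVelQuot u x| * ‖F x‖ ^ 2) volume := by
      have h := iFsq.bdd_mul (hΦm.norm) (ae_of_all _ fun x => by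
        rw [norm_norm, Real.norm_eq_abs]; exact hΦb x)
      refine h.congr (Eventually.of_forall fun x => ?_)
      simp only [Real.norm_eq_abs, sq_abs]
      rfl
    have hBi : Integrable (fun x => ‖fderiv ℝ F x (eR x)‖ ^ 2) volume := by
      have hmeas : AEStronglyMeasurable (fun x => ‖fderiv ℝ F x (eR x)‖ ^ 2) volume := by
        have hcF : Continuous (fderiv ℝ F) := hF.continuous_fderiv one_ne_zero
        have happly : Measurable fun x => fderiv ℝ F x (eR x) := by
          have hb : Continuous fun p : (EuclideanSpace ℝ (Fin 3) →L[ℝ] ℝ) × EuclideanSpace ℝ (Fin 3) =>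
              p.1 p.2 :=
            (isBoundedBilinearMap_apply (𝕜 := ℝ) (E := EuclideanSpace ℝ (Fin 3)) (F := ℝ)).continuous
          exact hb.measurable.comp (hcF.measurable.prodMk measurable_eR')
        exact (happly.norm.pow_const 2).aestronglyMeasurable
      refine iGF.mono' hmeas (Eventually.of_forall fun x => ?_)
      rw [Real.norm_eq_abs, abs_of_nonneg (sq_nonneg _), Real.norm_eq_abs, sq_abs]
      exact sq_fderiv_apply_eR_le F x
    have hCi : Integrable (fun x => ‖F x‖ ^ 2) volume :=
      iFsq.congr (Eventually.of_forall fun x => by simp only [Real.norm_eq_abs, sq_abs])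
    have h := integral_abs_angVelQuot_mul_norm_sq_le (F := F) haxt hu2 hF hFn' hDFn' hδ h2δ hC₁0 hM
      hmod hbd hAi hBi hCi
    -- rewrite the norms as squares
    have e1 : ∫ x, |angVelQuot u x| * ‖F x‖ ^ 2 = ∫ x, |Φ x| * F x ^ 2 :=
      integral_congr_ae (Eventually.of_forall fun x => by simp only [Real.norm_eq_abs, sq_abs]; rfl)
    have e2 : ∫ x, ‖fderiv ℝ F x (eR x)‖ ^ 2 ≤ ∫ x, (fderiv ℝ F x (EuclideanSpace.single 0 1) ^ 2 +
        fderiv ℝ F x (EuclideanSpace.single 1 1) ^ 2 + fderiv ℝ F x (EuclideanSpace.single 2 1) ^ 2) :=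
      integral_mono hBi iGF fun x => by
        rw [Real.norm_eq_abs, sq_abs]; exact sq_fderiv_apply_eR_le F x
    have e3 : ∫ x in {x | δ < cylRadius x}, ‖F x‖ ^ 2 = ∫ x in {x | δ < cylRadius x}, F x ^ 2 :=
      integral_congr_ae (Eventually.of_forall fun x => by simp only [Real.norm_eq_abs, sq_abs])
    rw [e1, e3] at h
    have hCs : (16 * C₁ : ℝ) = Cs := rfl
    have hC0eq : (16 * C₁ * Wei2016.stDerivBound ^ 2 + 2 * M) / δ ^ 2 = C0 := rfl
    rw [hCs, hC0eq] at h
    have e4 := mul_le_mul_of_nonneg_left e2 hCs0.le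
    linarith
  have hfbcΩ := hfbc1 hΩc1 hΩax hΩ0 hΩ1
  have hfbcJ := hfbc1 hJc1 hJax hJ0 hJ1
  -- the outer terms of (FBC-1): `∫_{r>δ} Ω², ∫_{r>δ} J² ≤ δ⁻² c² E1`
  have hOutΩ : ∫ x in {x | δ < cylRadius x}, Ω x ^ 2 ≤ δ⁻¹ ^ 2 * (c ^ 2 * E1) := by
    have h := setIntegral_sq_le_of_abs_le_div (Q := Ω) (g := fun x => ‖curl u x‖) hδ
      (fun x hx => haxt.abs_angVortQuot_le_norm_curl_div hu3 hx) hΩ0.integrable_sq.integrableOn iωsq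
    exact h.trans (mul_le_mul_of_nonneg_left hωsq (by positivity))
  have hOutJ : ∫ x in {x | δ < cylRadius x}, J x ^ 2 ≤ δ⁻¹ ^ 2 * (c ^ 2 * E1) := by
    have h := setIntegral_sq_le_of_abs_le_div (Q := J) (g := fun x => ‖curl u x‖) hδ
      (fun x hx => haxt.abs_radVelQuot_curl_le_norm_curl_div hu3 hx) hJ0.integrable_sq.integrableOn iωsq
    exact h.trans (mul_le_mul_of_nonneg_left hωsq (by positivity))
  -- Young: `−2∫ΩΦJ ≤ (1/(2Cs)) ∫|Φ|Ω² + 2Cs ∫|Φ|J²`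
  have iΦΩ : Integrable (fun x => |Φ x| * Ω x ^ 2) volume :=
    (hΩ0.integrable_sq.bdd_mul hΦm.norm (ae_of_all _ fun x => by
      rw [norm_norm, Real.norm_eq_abs]; exact hΦb x)).congr
      (Eventually.of_forall fun x => by simp only [Real.norm_eq_abs])
  have iΦJ : Integrable (fun x => |Φ x| * J x ^ 2) volume :=
    (hJ0.integrable_sq.bdd_mul hΦm.norm (ae_of_all _ fun x => by
      rw [norm_norm, Real.norm_eq_abs]; exact hΦb x)).congr
      (Eventually.of_forall fun x => by simp only [Real.norm_eq_abs])
  have hYoung : -2 * ∫ x, Ω x * (Φ x * J x) ≤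
      1 / (2 * Cs) * (∫ x, |Φ x| * Ω x ^ 2) + 2 * Cs * ∫ x, |Φ x| * J x ^ 2 := by
    rw [← integral_const_mul, ← integral_const_mul, ← integral_const_mul,
      ← integral_add (iΦΩ.const_mul _) (iΦJ.const_mul _)]
    refine integral_mono (hRΩ.const_mul _) ((iΦΩ.const_mul _).add (iΦJ.const_mul _)) fun x => ?_
    beta_reduce
    have hCs2 : 0 < 2 * Cs := by positivity
    -- `2|Ω||J| ≤ Ω²/(2Cs) + 2Cs J²`
    have h1 : 2 * (|Ω x| * |J x|) ≤ 1 / (2 * Cs) * Ω x ^ 2 + 2 * Cs * J x ^ 2 := by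
      have key : 0 ≤ (|Ω x| - 2 * Cs * |J x|) ^ 2 := sq_nonneg _
      have e : 1 / (2 * Cs) * Ω x ^ 2 + 2 * Cs * J x ^ 2 - 2 * (|Ω x| * |J x|) =
          (|Ω x| - 2 * Cs * |J x|) ^ 2 / (2 * Cs) := by
        rw [← sq_abs (Ω x), ← sq_abs (J x)]
        field_simp
        ring
      have : 0 ≤ (|Ω x| - 2 * Cs * |J x|) ^ 2 / (2 * Cs) := div_nonneg key hCs2.le
      linarith
    have h2 : -2 * (Ω x * (Φ x * J x)) ≤ |Φ x| * (2 * (|Ω x| * |J x|)) := by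
      have : |2 * (Ω x * (Φ x * J x))| = |Φ x| * (2 * (|Ω x| * |J x|)) := by
        rw [abs_mul, abs_mul, abs_mul, abs_two]; ring
      have := neg_abs_le (2 * (Ω x * (Φ x * J x)))
      linarith
    calc -2 * (Ω x * (Φ x * J x)) ≤ |Φ x| * (2 * (|Ω x| * |J x|)) := h2
      _ ≤ |Φ x| * (1 / (2 * Cs) * Ω x ^ 2 + 2 * Cs * J x ^ 2) :=
          mul_le_mul_of_nonneg_left h1 (abs_nonneg _)
      _ = 1 / (2 * Cs) * (|Φ x| * Ω x ^ 2) + 2 * Cs * (|Φ x| * J x ^ 2) := by ring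
  /- ───── Step 8: bookkeeping ───── -/
  -- abbreviate the remaining integrals
  set aΩ : ℝ := ∫ x, Ω x * angVortQuot (timeDerivWithin S v t) x with haΩ
  set aJ : ℝ := ∫ x, J x * radVelQuot (curl (timeDerivWithin S v t)) x with haJ
  set N₁ : ℝ := ∫ x, Ω x * (Φ x * J x) with hN₁
  set N₂ : ℝ := ∫ x, J x * fderiv ℝ W x (curl u x) with hN₂
  set Sw : ℝ := ∫ x, (cylRadius x * angVelQuot u x) ^ 2 * ‖gradient W x‖ ^ 2 with hSw_def
  set PW : ℝ := ∫ x, ‖fderiv ℝ (gradient W) x (eR x)‖ ^ 2 with hPW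
  set OutW : ℝ := ∫ x in {x | δ < cylRadius x}, ‖gradient W x‖ ^ 2 with hOutW_def
  set IΦΩ : ℝ := ∫ x, |Φ x| * Ω x ^ 2 with hIΦΩ
  set IΦJ : ℝ := ∫ x, |Φ x| * J x ^ 2 with hIΦJ
  set OutΩ : ℝ := ∫ x in {x | δ < cylRadius x}, Ω x ^ 2 with hOutΩ_def
  set OutJ : ℝ := ∫ x in {x | δ < cylRadius x}, J x ^ 2 with hOutJ_def
  set ZΩ : ℝ := ∫ x, fderiv ℝ Ω x (EuclideanSpace.single 2 1) ^ 2 with hZΩ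
  -- nonnegativity of the gradient integrals
  have hGΩ0 : 0 ≤ GΩ := integral_nonneg fun x => by positivity
  have hGJ0 : 0 ≤ GJ := integral_nonneg fun x => by positivity
  have hPW0 : 0 ≤ PW := integral_nonneg fun x => by positivity
  -- the FBC-2 constants of `hDfbc` are `δs` and `C0'`
  have hδs_eq : 16 * C₁ ^ 2 / Real.log (2 * δ) ^ 2 = δs := rfl
  have hC0'_eq : (16 * C₁ ^ 2 * Wei2016.stDerivBound ^ 2 / Real.log (2 * δ) ^ 2 + 2 * M ^ 2) / δ ^ 2 = C0' := rfl
  rw [hδs_eq, hC0'_eq] at hDfbc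
  -- hDfbc : Sw ≤ δs * PW + C0' * OutW
  -- the smallness `4 Cs² δs ≤ 1/4`
  have hsmall' : 4 * Cs ^ 2 * δs ≤ 1 / 4 := by
    have e1 : 4 * Cs ^ 2 * δs = 16384 * C₁ ^ 4 / L2 := by
      rw [hδs_def, hCs_def]; ring
    rw [e1, div_le_iff₀ hL2pos]
    linarith only [hsmall]
  -- scaled inequalities
  have s1 : δs * PW ≤ δs * GΩ := mul_le_mul_of_nonneg_left (hEW.trans hzΩ) hδs0
  have s2 : C0' * OutW ≤ C0' * (18 / δ ^ 4 * E0 + 2 / δ ^ 2 * E1) := mul_le_mul_of_nonneg_left hOutW hC0'0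
  have s3 : 1 / (2 * Cs) * IΦΩ ≤ 1 / (2 * Cs) * (Cs * GΩ + C0 * OutΩ) :=
    mul_le_mul_of_nonneg_left hfbcΩ (by positivity)
  have s4 : 2 * Cs * IΦJ ≤ 2 * Cs * (Cs * GJ + C0 * OutJ) := mul_le_mul_of_nonneg_left hfbcJ (by positivity)
  have s5 : 1 / (2 * Cs) * (C0 * OutΩ) ≤ 1 / (2 * Cs) * (C0 * (δ⁻¹ ^ 2 * (c ^ 2 * E1))) :=
    mul_le_mul_of_nonneg_left (mul_le_mul_of_nonneg_left hOutΩ hC00) (by positivity)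
  have s6 : 2 * Cs * (C0 * OutJ) ≤ 2 * Cs * (C0 * (δ⁻¹ ^ 2 * (c ^ 2 * E1))) :=
    mul_le_mul_of_nonneg_left (mul_le_mul_of_nonneg_left hOutJ hC00) (by positivity)
  have s7 : 4 * Cs ^ 2 * δs * GΩ ≤ 1 / 4 * GΩ := mul_le_mul_of_nonneg_right hsmall' hGΩ0
  have hinv : 1 / (2 * Cs) * Cs = 1 / 2 := by field_simp
  have s8 : (1 / (2 * Cs)) * (Cs * GΩ) = (1 / 2) * GΩ := by rw [← mul_assoc, hinv]
  -- (I): aΩ + GΩ ≤ ½GΩ + 2Cs²GJ + K₁E1 ; (II): aJ + GJ ≤ ½GJ + ½(δs GΩ + C0' OutW-bound)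
  have hI : aΩ + GΩ ≤ 1 / 2 * GΩ + 2 * Cs ^ 2 * GJ +
      (C0 / (2 * Cs) + 2 * Cs * C0) * c ^ 2 * δ⁻¹ ^ 2 * E1 := by
    have e : (C0 / (2 * Cs) + 2 * Cs * C0) * c ^ 2 * δ⁻¹ ^ 2 * E1 =
        1 / (2 * Cs) * (C0 * (δ⁻¹ ^ 2 * (c ^ 2 * E1))) + 2 * Cs * (C0 * (δ⁻¹ ^ 2 * (c ^ 2 * E1))) := by
      ring
    rw [e]
    have e2 : 2 * Cs * (Cs * GJ) = 2 * Cs ^ 2 * GJ := by ring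
    have e3 : 1 / (2 * Cs) * (Cs * GΩ + C0 * OutΩ) = 1 / (2 * Cs) * (Cs * GΩ) + 1 / (2 * Cs) * (C0 * OutΩ) := by
      ring
    have e5 : 2 * Cs * (Cs * GJ + C0 * OutJ) = 2 * Cs * (Cs * GJ) + 2 * Cs * (C0 * OutJ) := by ring
    linarith only [hA, hYoung, s3, s4, s5, s6, s8, e2, e3, e5]
  have hII : aJ + 1 / 2 * GJ ≤ 1 / 2 * (δs * GΩ) + 1 / 2 * (C0' * (18 / δ ^ 4 * E0 + 2 / δ ^ 2 * E1)) := by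
    linarith only [hBJ, hC, hDfbc, s1, s2]
  -- add `hI + 8Cs² · hII`
  have hCs2pos : 0 ≤ 8 * Cs ^ 2 := by positivity
  have hsum := add_le_add hI (mul_le_mul_of_nonneg_left hII hCs2pos)
  -- conclude
  have hKsplit : K * (E0 + E1) = (C0 / (2 * Cs) + 2 * Cs * C0) * c ^ 2 * δ⁻¹ ^ 2 * E0 +
      ((C0 / (2 * Cs) + 2 * Cs * C0) * c ^ 2 * δ⁻¹ ^ 2 * E1 +
        4 * Cs ^ 2 * C0' * (18 / δ ^ 4 + 2 / δ ^ 2) * (E0 + E1)) := by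
    rw [hK]; ring
  have hextra1 : 0 ≤ (C0 / (2 * Cs) + 2 * Cs * C0) * c ^ 2 * δ⁻¹ ^ 2 * E0 := by positivity
  have hextra2 : 4 * Cs ^ 2 * C0' * (18 / δ ^ 4 * E0 + 2 / δ ^ 2 * E1) ≤
      4 * Cs ^ 2 * C0' * (18 / δ ^ 4 + 2 / δ ^ 2) * (E0 + E1) := by
    have h1 : 18 / δ ^ 4 * E0 + 2 / δ ^ 2 * E1 ≤ (18 / δ ^ 4 + 2 / δ ^ 2) * (E0 + E1) := by
      have m1 := mul_nonneg (show (0:ℝ) ≤ 18 / δ ^ 4 by positivity) hE10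
      have m2 := mul_nonneg (show (0:ℝ) ≤ 2 / δ ^ 2 by positivity) hE00
      have ex : (18 / δ ^ 4 + 2 / δ ^ 2) * (E0 + E1) =
          18 / δ ^ 4 * E0 + 2 / δ ^ 2 * E1 + (18 / δ ^ 4 * E1 + 2 / δ ^ 2 * E0) := by ring
      rw [ex]; linarith only [m1, m2]
    calc 4 * Cs ^ 2 * C0' * (18 / δ ^ 4 * E0 + 2 / δ ^ 2 * E1)
        ≤ 4 * Cs ^ 2 * C0' * ((18 / δ ^ 4 + 2 / δ ^ 2) * (E0 + E1)) :=
          mul_le_mul_of_nonneg_left h1 (by positivity)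
      _ = 4 * Cs ^ 2 * C0' * (18 / δ ^ 4 + 2 / δ ^ 2) * (E0 + E1) := by ring
  rw [hKsplit]
  have hexp : (aΩ + GΩ) + 8 * Cs ^ 2 * (aJ + 1 / 2 * GJ) =
      aΩ + 8 * Cs ^ 2 * aJ + GΩ + 4 * Cs ^ 2 * GJ := by ring
  have hexp2 : 1 / 2 * GΩ + 2 * Cs ^ 2 * GJ + (C0 / (2 * Cs) + 2 * Cs * C0) * c ^ 2 * δ⁻¹ ^ 2 * E1 +
      8 * Cs ^ 2 * (1 / 2 * (δs * GΩ) + 1 / 2 * (C0' * (18 / δ ^ 4 * E0 + 2 / δ ^ 2 * E1))) =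
      1 / 2 * GΩ + 2 * Cs ^ 2 * GJ + (C0 / (2 * Cs) + 2 * Cs * C0) * c ^ 2 * δ⁻¹ ^ 2 * E1 +
        4 * Cs ^ 2 * δs * GΩ + 4 * Cs ^ 2 * C0' * (18 / δ ^ 4 * E0 + 2 / δ ^ 2 * E1) := by ring
  rw [hexp, hexp2] at hsum
  linarith only [hsum, s7, hextra1, hextra2, hGΩ0, hGJ0]

end Slice

end LeiZhang2017

end Literature.Analysis.FluidPDE
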